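import Summits.ValiantsHypothesis.ValiantsHypothesis.Theorems.KPlusLogSqLawTropicalGradedWalkPotX
import Summits.ValiantsHypothesis.ValiantsHypothesis.Theorems.KPlusLogSqLawTropicalGradedWalkDomDGlue1
import Summits.ValiantsHypothesis.ValiantsHypothesis.Theorems.KPlusLogSqLawTropicalGradedWalkLift
import Summits.ValiantsHypothesis.ValiantsHypothesis.Theorems.KPlusLogSqLawTropicalGradedWalkDomX1
import Summits.ValiantsHypothesis.ValiantsHypothesis.Theorems.KPlusLogSqLawTropicalGradedWalkDomX2
import Summits.ValiantsHypothesis.ValiantsHypothesis.Theorems.KPlusLogSqLawTropicalGradedWalkDomX3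
import Summits.ValiantsHypothesis.ValiantsHypothesis.Theorems.KPlusLogSqLawTropicalGradedWalkDomX4
import Summits.ValiantsHypothesis.ValiantsHypothesis.Theorems.KPlusLogSqLawTropicalGradedWalkDomX5
import Summits.ValiantsHypothesis.ValiantsHypothesis.Theorems.KPlusLogSqLawTropicalGradedWalkDomX6
import Summits.ValiantsHypothesis.ValiantsHypothesis.Theorems.KPlusLogSqLawTropicalGradedWalkDomX7
import Summits.ValiantsHypothesis.ValiantsHypothesis.Theorems.KPlusLogSqLawTropicalGradedWalkDomX8
import Summits.ValiantsHypothesis.ValiantsHypothesis.Theorems.KPlusLogSqLawTropicalGradedWalkDomX9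
import Summits.ValiantsHypothesis.ValiantsHypothesis.Theorems.KPlusLogSqLawTropicalGradedWalkDomX10
import Summits.ValiantsHypothesis.ValiantsHypothesis.Theorems.KPlusLogSqLawTropicalGradedWalkDomX11
import Summits.ValiantsHypothesis.ValiantsHypothesis.Theorems.KPlusLogSqLawTropicalGradedWalkDomX12
import Summits.ValiantsHypothesis.ValiantsHypothesis.Theorems.KPlusLogSqLawTropicalGradedWalkDomX13
import Summits.ValiantsHypothesis.ValiantsHypothesis.Theorems.KPlusLogSqLawTropicalGradedWalkDomX14

/-!
# Dominance glue (type X), part 1: interface lemmas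

GRW-lite `K = 4` graded-walk family (census side of the tropical root law, all `m`):
dominance glue for the EXCURSION states `(w, u, 1)`, `2 ≤ u ≤ w − 1 < m − 1`, of the design typed in
`KPlusLogSqLawTropicalGradedWalkDefs` (Leibniz term: the diagonal term of `(w, u, 0)` with the rows of the columns
`u − 1`, `u` exchanged).  The slack of every rival cell against the row potential `UX` (file `…PotX`) was certified
family by family in `…DomX1` – `…DomX14`; the glue files dispatch an arbitrary rival `(a, b, l)` to its family
(far rivals are first reduced to the best class of their level by the generic lifts of `…GradedWalkLift`).

Honest framing: this is a census-side (lower-bound) construction — a quadratic family of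
distinct optimal slopes for `TropRootLawAt (n+1) 4`.  It says nothing about `TropicalB` inside
its window and nothing about VP ≠ VNP.
-/

set_option linter.dupNamespace false
set_option autoImplicit false

namespace Summit.ValiantsHypothesis.ValiantsHypothesis.Theorems.LacunarySymmetroidMatrixDescartes.TropicalCensus

namespace GradedWalk

open Summit.ValiantsHypothesis.ValiantsHypothesis.Theorems.MatrixDescartes.Negative

variable (n : ℕ)

/-! ### interface lemmas for the dominance glue (type X) -/

/-- value of the row `R₁ = m − w + u − 1` as an element of `Fin m`. -/
theorem R1f_val {w u : ℕ} (huw : u < w) (hw : w ≤ n + 1) :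
    (((⟨(n + 1 - w + u - 1) % (n + 1), Nat.mod_lt _ (Nat.succ_pos n)⟩ : Fin (n + 1)) : Fin (n + 1)) : ℕ) = n + 1 - w + u - 1 := Nat.mod_eq_of_lt (by omega)
/-- value of the row `R₂ = m − w + u`. -/
theorem R2f_val {w u : ℕ} (huw : u < w) (hw : w ≤ n + 1) :
    (((⟨(n + 1 - w + u) % (n + 1), Nat.mod_lt _ (Nat.succ_pos n)⟩ : Fin (n + 1)) : Fin (n + 1)) : ℕ) = n + 1 - w + u := Nat.mod_eq_of_lt (by omega)

/-- the excursion permutation: the phase rotation followed by the exchange of the rows `R₁`, `R₂`. -/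
theorem perm_X {w u : ℕ} (huw : u < w) :
    perm n w u 1 = Equiv.swap (⟨(n + 1 - w + u - 1) % (n + 1), Nat.mod_lt _ (Nat.succ_pos n)⟩ : Fin (n + 1)) (⟨(n + 1 - w + u) % (n + 1), Nat.mod_lt _ (Nat.succ_pos n)⟩ : Fin (n + 1)) * rot n w := by
  unfold perm
  rw [if_neg (Nat.ne_of_lt huw)]
  rfl

/-- values of the excursion permutation. -/
theorem sigmaX_val {w u : ℕ} (huw : u < w) (hw : w ≤ n + 1) (b : Fin (n + 1)) :
    ((perm n w u 1 b : Fin (n + 1)) : ℕ) =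
      if ((rot n w b : Fin (n + 1)) : ℕ) = n + 1 - w + u - 1 then n + 1 - w + u
      else if ((rot n w b : Fin (n + 1)) : ℕ) = n + 1 - w + u then n + 1 - w + u - 1
      else ((rot n w b : Fin (n + 1)) : ℕ) := by
  rw [perm_X n huw, Equiv.Perm.mul_apply, Equiv.swap_apply_def]
  have h1 := R1f_val n huw hw
  have h2 := R2f_val n huw hw
  by_cases e1 : rot n w b = (⟨(n + 1 - w + u - 1) % (n + 1), Nat.mod_lt _ (Nat.succ_pos n)⟩ : Fin (n + 1))
  · rw [if_pos e1, if_pos (by rw [e1, h1]), h2]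
  · rw [if_neg e1]
    have e1' : ((rot n w b : Fin (n + 1)) : ℕ) ≠ n + 1 - w + u - 1 := fun h => e1 (Fin.ext (by rw [h, h1]))
    rw [if_neg e1']
    by_cases e2 : rot n w b = (⟨(n + 1 - w + u) % (n + 1), Nat.mod_lt _ (Nat.succ_pos n)⟩ : Fin (n + 1))
    · rw [if_pos e2, if_pos (by rw [e2, h2]), h1]
    · rw [if_neg e2]
      have e2' : ((rot n w b : Fin (n + 1)) : ℕ) ≠ n + 1 - w + u := fun h => e2 (Fin.ext (by rw [h, h2]))
      rw [if_neg e2']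

/-- the excursion permutation on an ordinary block column. -/
theorem sigmaX_blk {w u : ℕ} (huw : u < w) (hw : w ≤ n + 1) (b : Fin (n + 1)) (hb : (b : ℕ) < w)
    (h1 : (b : ℕ) + 1 ≠ u) (h2 : (b : ℕ) ≠ u) : ((perm n w u 1 b : Fin (n + 1)) : ℕ) = (b : ℕ) + (n + 1 - w) := by
  have hr : ((rot n w b : Fin (n + 1)) : ℕ) = (b : ℕ) + (n + 1 - w) := rot_val_blk n hw b hb
  have hc1 : ((rot n w b : Fin (n + 1)) : ℕ) ≠ n + 1 - w + u - 1 := by rw [hr]; omega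
  have hc2 : ((rot n w b : Fin (n + 1)) : ℕ) ≠ n + 1 - w + u := by rw [hr]; omega
  rw [sigmaX_val n huw hw, if_neg hc1, if_neg hc2, hr]

/-- … on the lowered column `u − 1`. -/
theorem sigmaX_um1 {w u : ℕ} (huw : u < w) (hw : w ≤ n + 1) (b : Fin (n + 1)) (hb : (b : ℕ) + 1 = u) :
    ((perm n w u 1 b : Fin (n + 1)) : ℕ) = n + 1 - w + u := by
  have hr : ((rot n w b : Fin (n + 1)) : ℕ) = (b : ℕ) + (n + 1 - w) := rot_val_blk n hw b (by omega)
  have hc1 : ((rot n w b : Fin (n + 1)) : ℕ) = n + 1 - w + u - 1 := by rw [hr]; omega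
  rw [sigmaX_val n huw hw, if_pos hc1]

/-- … on the lifted column `u`. -/
theorem sigmaX_u {w u : ℕ} (huw : u < w) (hw : w ≤ n) (b : Fin (n + 1)) (hb : (b : ℕ) = u) :
    ((perm n w u 1 b : Fin (n + 1)) : ℕ) = n + 1 - w + u - 1 := by
  have hw1 : w ≤ n + 1 := by omega
  have hr : ((rot n w b : Fin (n + 1)) : ℕ) = (b : ℕ) + (n + 1 - w) := rot_val_blk n hw1 b (by omega)
  have hc1 : ((rot n w b : Fin (n + 1)) : ℕ) ≠ n + 1 - w + u - 1 := by rw [hr]; omega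
  have hc2 : ((rot n w b : Fin (n + 1)) : ℕ) = n + 1 - w + u := by rw [hr]; omega
  rw [sigmaX_val n huw hw1, if_neg hc1, if_pos hc2]

/-- … on a wrap column. -/
theorem sigmaX_wrap {w u : ℕ} (huw : u < w) (hu : 1 ≤ u) (hw : w ≤ n) (b : Fin (n + 1)) (hb : w ≤ (b : ℕ)) :
    ((perm n w u 1 b : Fin (n + 1)) : ℕ) = (b : ℕ) - w := by
  have hw1 : w ≤ n + 1 := by omega
  have hbn : (b : ℕ) ≤ n := Nat.lt_succ_iff.mp b.isLt
  have hr : ((rot n w b : Fin (n + 1)) : ℕ) = (b : ℕ) - w := rot_val_wrap n hw1 b hb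
  have hc1 : ((rot n w b : Fin (n + 1)) : ℕ) ≠ n + 1 - w + u - 1 := by rw [hr]; omega
  have hc2 : ((rot n w b : Fin (n + 1)) : ℕ) ≠ n + 1 - w + u := by rw [hr]; omega
  rw [sigmaX_val n huw hw1, if_neg hc1, if_neg hc2, hr]

/-- the class map of an excursion state. -/
theorem lam_X {w u : ℕ} (huw : u < w) (b : Fin (n + 1)) :
    lam n w u 1 b = if w ≤ (b : ℕ) then 0 else if (b : ℕ) + 1 < u then 2 else if (b : ℕ) < u then 3 else 1 := by
  unfold lam
  rw [if_neg (Nat.ne_of_lt huw)]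

/-- the excursion slope lies below `L·E` for every future level `E > w`. -/
theorem thX_le_LE {w u E : ℕ} (hu : u < w) (hw : w ≤ n) (hE : w + 1 ≤ E) : thX n w u ≤ LL n * E := by
  have huz : (u : ℤ) + 1 ≤ w := by exact_mod_cast hu
  have hwz : (w : ℤ) ≤ n := by exact_mod_cast hw
  have hEz : (w : ℤ) + 1 ≤ E := by exact_mod_cast hE
  unfold thX LL MM
  nlinarith [mul_le_mul_of_nonneg_left hEz (show (0 : ℤ) ≤ 8 * ((n : ℤ) + 1) * ((n : ℤ) + 4) by positivity),
    mul_nonneg (show (0 : ℤ) ≤ (n : ℤ) - w by linarith) (show (0 : ℤ) ≤ (n : ℤ) + 4 by positivity)]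

/-- … in particular below `L·m`. -/
theorem thX_le_top {w u : ℕ} (hu : u < w) (hw : w ≤ n) : thX n w u ≤ LL n * ((n : ℤ) + 1) := by
  have h := thX_le_LE n hu hw (le_refl (w + 1))
  have hwz : (w : ℤ) + 1 ≤ (n : ℤ) + 1 := by exact_mod_cast Nat.succ_le_succ hw
  have hL : (0 : ℤ) ≤ LL n := by unfold LL; positivity
  push_cast at h
  nlinarith [mul_le_mul_of_nonneg_left hwz hL]

/-- the excursion slope lies above `L·(E+1)` for every past level `E < w`. -/
theorem LE_le_thX {w E : ℕ} (u : ℕ) (hE : E + 1 ≤ w) : LL n * (E + 1) ≤ thX n w u := by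
  have hEz : (E : ℤ) + 1 ≤ w := by exact_mod_cast hE
  have hL : (0 : ℤ) ≤ LL n := by unfold LL; positivity
  have hM : (0 : ℤ) ≤ MM n * u := by unfold MM; positivity
  unfold thX
  nlinarith [mul_le_mul_of_nonneg_left hEz hL]

/-- bend at `u + 1` (equation form). -/
theorem muX_P' {w u j : ℕ} (h : j = u + 1) : muX n w u j = SXP n w u := by subst h; exact muX_P n w u

/-- combine a class lift with a family inequality. -/
theorem lift_combine {X X3 D T : ℤ} {l : Fin 4} (hlift : X + (if l = 3 then 0 else 1) ≤ X3) (hF : X3 + 1 ≤ D + T) :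
    X + 1 ≤ D + T := by
  split_ifs at hlift <;> linarith

/-- a diagonal cell of class `≥ 1` is present. -/
theorem ee_diag_ne {a b : Fin (n + 1)} (h : (a : ℕ) = (b : ℕ)) (l : Fin 4) (hl : (l : ℕ) ≠ 0) : ee n a b l ≠ 0 := by
  unfold ee; rw [if_neg (by omega), if_pos h, if_neg hl]
  split_ifs <;>
  · intro h0
    have h0' := congrArg Int.natAbs h0
    simp at h0'

end GradedWalk

end Summit.ValiantsHypothesis.ValiantsHypothesis.Theorems.LacunarySymmetroidMatrixDescartes.TropicalCensus
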